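import Literature.NumberTheory.EllipticCurves.NewformPeterssonSizeSymmSqLZeroFreeProofs
import Literature.NumberTheory.EllipticCurves.NewformSymmSquareJ0Hecke
import HarnessLib

/-!
# Murty's bound `(f, f) ≫ N^{1−ε}` from "no exceptional zero" on the non-CM members only

Topic `NumberTheory/EllipticCurves`; namespace `Literature.NumberTheory.EllipticCurves.ModularForms`.
A proofs-only file (theorems only: no definition, no named fact, no instance; D-0026) in support of
the named fact `murty_petersson_newform_lower_bound` (`NewformPeterssonSize`; Murty 1999 §2 (3) ⇐
Hoffstein–Lockhart 1994 / Iwaniec–Kowalski Cor. 5.45). It assembles two lines of the tree: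

* the EFFECTIVE line `NewformPeterssonSizeSymmSqLZeroFreeProofs`
  (`IsNewform0.petersson_lower_bound_log_of_symmSqL_zeroFree`: for every `f ∈ S₂(Γ₀(N))` with
  `a₁ = 1`, if `L_f = symmSqL N f` has no real zero on `[1 − 1/(A log(N+2)), 1)` then
  `Re (f,f) ≥ c N/log(N+2)` — Estermann's lemma for `ζ₁ L_f` on the Siegel disc), and
* the CM line `NewformSymmSquareJ1728Hecke` / `NewformSymmSquareTwistClass` /
  `NewformPeterssonSizeCMReductionProofs` (`exists_petersson_ge_of_hasCM_of_j_ne_zero`: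
  `Re (f,f) ≥ c(ε) N^{1−ε}` for the newforms of all CM curves with `j ≠ 0`, via Hecke
  `L`-functions of `ℚ(i)` and quadratic-twist classes),

into the reduction of the named fact to EXACTLY

1. the theorem of Goldfeld–Hoffstein–Lieman (appendix to Hoffstein–Lockhart 1994) = Iwaniec–Kowalski
   Thm. 5.44 (2), in the special case consumed here and stated INLINE as a hypothesis (its named
   form is `GoldfeldHoffsteinLieman1994_symmSq_noExceptionalZero`, `SymmSquareNoExceptionalZero.lean`,
   filed separately): there is `c > 0` such that for the newform `f` of every NON-CM elliptic curve
   of conductor `N`, `symmSqL N f σ ≠ 0` for `1 − c/log(N+2) ≤ σ < 1`; and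
2. the bound on the single CM family `j = 0` (`y² = x³ + k`, CM by `ℤ[ζ₃]`; Hecke `L`-functions of
   `ℚ(√−3)`), in the shape `hCM0` of `murty_petersson_newform_lower_bound_of_pairData_nonCM_of_j_zero`.

Main results:

* `petersson_lower_bound_log_of_noExceptionalZero_nonCM` — **IK Cor. 5.45 (5.104) for non-CM
  elliptic newforms**: from 1., `c N/log(N+2) ≤ Re (f,f)_{Γ₀(N)}` with one `c > 0` for all non-CM
  `W` (effective in the input);
* `petersson_lower_bound_of_noExceptionalZero_nonCM` — hence `c(ε) N^{1−ε} ≤ Re (f,f)`;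
* `murty_petersson_newform_lower_bound_of_noExceptionalZero_nonCM_of_hasCM` — the named fact from
  1. and ANY proof of the bound on the CM members;
* `murty_petersson_newform_lower_bound_of_noExceptionalZero_nonCM_of_j_zero` — the named fact from
  1. and 2. only (CM with `j ≠ 0` discharged in the tree);
* **`murty_petersson_newform_lower_bound_of_noExceptionalZero_nonCM`** — the named fact from 1. ALONE,
  2. being now a theorem of the tree (`exists_petersson_ge_of_j_eq_zero`, `NewformSymmSquareJ0Hecke`:
  Hecke `L`-functions of `ℚ(√−3)` with cubic Grössencharacters).

So after this file the named fact rests on ONE published theorem about the non-CM forms (GHL,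
Iwaniec–Kowalski Thm. 5.44 (2)); the ineffective Siegel-type route through the explicit `GL₃ × GL₃`
pair function (`NewformPeterssonSizePairReductionProofs`, `RankinSymmSquarePairSeries`) is the
alternative for 1.

## References

* H. Iwaniec, E. Kowalski, *Analytic Number Theory*, AMS Coll. Publ. 53 (2004), Thm. 5.44 (2),
  Cor. 5.45 (5.103)–(5.104). [cite: IwaniecKowalski2004, Thm. 5.44 (2) and Cor. 5.45]
* J. Hoffstein, P. Lockhart, *Coefficients of Maass forms and the Siegel zero* (appendix by
  D. Goldfeld, J. Hoffstein, D. Lieman), Ann. of Math. 140 (1994), 161–181.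
  [cite: HoffsteinLockhart1994, Thm. 0.1 and Appendix]
* M. R. Murty, *Bounds for congruence primes*, Proc. Sympos. Pure Math. 66.1 (1999), §2 (3).
  [cite: MurtyCongruencePrimes1999, §2 (3)]

## Mathlib / tree search

Tree: `IsNewform0.petersson_lower_bound_log_of_symmSqL_zeroFree`,
`murty_petersson_newform_lower_bound_of_symmSqL_noExceptionalZero` (the all-members version of the
deduction below; `NewformPeterssonSizeSymmSqLZeroFreeProofs`); `exists_petersson_ge_of_hasCM_of_j_ne_zero`
(`NewformPeterssonSizeCMReductionProofs`); `exists_petersson_ge_of_j_eq_zero` (`NewformSymmSquareJ0Hecke`);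
`symmSqLOne_eq` (`symmSqLOne f = 8π³ Re(f,f)/N`,
`CuspFormSymmSquareLSeries`); `EllipticNewformIndex` (`NewformPeterssonSizeSiegelReductionProofs`);
`WeierstrassCurve.HasCM` (`Isogeny`). Mathlib: `Real.log_le_rpow_div`, `Real.rpow_add`.
-/

noncomputable section

open scoped Real
open Complex CongruenceSubgroup

namespace Literature.NumberTheory.EllipticCurves.ModularForms

/-! ### The non-CM members: IK Cor. 5.45 (5.104) from "no exceptional zero" -/

/-- **`(f, f) ≫ N/log N` for the newforms of non-CM elliptic curves, from the theorem of
Goldfeld–Hoffstein–Lieman** (IK Thm. 5.44 (2) ⇒ Cor. 5.45 (5.104), for these forms): if there is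
`c₀ > 0` such that `L_f(σ) = symmSqL N f σ ≠ 0` for `1 − c₀/log(N+2) ≤ σ < 1` whenever `IsNewformOf W f`
with `¬ W.HasCM`, then there is `c > 0` with `c N/log(N+2) ≤ Re (f,f)_{Γ₀(N)}` for all such `f`
(`IsNewform0.petersson_lower_bound_log_of_symmSqL_zeroFree` with `A = max A₀ (1/c₀)`, whose interval
`[1 − 1/(A log(N+2)), 1)` lies inside the zero-free one). [cite: IwaniecKowalski2004, Thm. 5.44 (2) and Cor. 5.45 (5.104)] -/
theorem petersson_lower_bound_log_of_noExceptionalZero_nonCM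
    (h : ∃ c₀ : ℝ, 0 < c₀ ∧ ∀ (N : ℕ) [NeZero N] (W : WeierstrassCurve ℚ) [W.IsElliptic]
      (f : CuspForm (Gamma0 N) 2), IsNewformOf W f → ¬ W.HasCM →
        ∀ σ : ℝ, 1 - c₀ / Real.log (N + 2) ≤ σ → σ < 1 → symmSqL N f σ ≠ 0) :
    ∃ c : ℝ, 0 < c ∧ ∀ (N : ℕ) [NeZero N] (W : WeierstrassCurve ℚ) [W.IsElliptic]
      (f : CuspForm (Gamma0 N) 2), IsNewformOf W f → ¬ W.HasCM →
        c * N / Real.log (N + 2) ≤ (peterssonProduct (Gamma0 N) 2 f f).re := by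
  obtain ⟨c₀, hc₀, hZ⟩ := h
  obtain ⟨A₀, hA₀, h1⟩ := IsNewform0.petersson_lower_bound_log_of_symmSqL_zeroFree
  obtain ⟨c, hc, hcN⟩ := h1 (max A₀ (1 / c₀)) (le_max_left _ _)
  refine ⟨c, hc, fun N _ W _ f hf hCM ↦ hcN N f hf.1 fun σ h1σ h2σ ↦ hZ N W f hf hCM σ ?_ h2σ⟩
  have hN0 : (0 : ℝ) ≤ N := Nat.cast_nonneg N
  have hlog : 0 < Real.log ((N : ℝ) + 2) := Real.log_pos (by linarith)
  -- `1/(A log) ≤ c₀/log` since `c₀ A ≥ c₀ · (1/c₀) = 1`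
  have hM : 1 ≤ c₀ * max A₀ (1 / c₀) := by
    have : c₀ * (1 / c₀) ≤ c₀ * max A₀ (1 / c₀) :=
      mul_le_mul_of_nonneg_left (le_max_right _ _) hc₀.le
    rwa [mul_one_div_cancel hc₀.ne'] at this
  have hle : 1 / (max A₀ (1 / c₀) * Real.log (N + 2)) ≤ c₀ / Real.log (N + 2) := by
    rw [div_le_div_iff₀ (by positivity) hlog]
    nlinarith
  linarith

/-- **`(f, f) ≥ c(ε) N^{1−ε}` for the newforms of non-CM elliptic curves**, from the same input
(`log(N+2) ≤ (3N)^ε/ε`). [cite: IwaniecKowalski2004, Thm. 5.44 (2) and Cor. 5.45] [cite: HoffsteinLockhart1994, Thm. 0.1 and Appendix] -/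
theorem petersson_lower_bound_of_noExceptionalZero_nonCM
    (h : ∃ c₀ : ℝ, 0 < c₀ ∧ ∀ (N : ℕ) [NeZero N] (W : WeierstrassCurve ℚ) [W.IsElliptic]
      (f : CuspForm (Gamma0 N) 2), IsNewformOf W f → ¬ W.HasCM →
        ∀ σ : ℝ, 1 - c₀ / Real.log (N + 2) ≤ σ → σ < 1 → symmSqL N f σ ≠ 0)
    {ε : ℝ} (hε : 0 < ε) :
    ∃ c : ℝ, 0 < c ∧ ∀ (N : ℕ) [NeZero N] (W : WeierstrassCurve ℚ) [W.IsElliptic]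
      (f : CuspForm (Gamma0 N) 2), IsNewformOf W f → ¬ W.HasCM →
        c * (N : ℝ) ^ (1 - ε) ≤ (peterssonProduct (Gamma0 N) 2 f f).re := by
  obtain ⟨c, hc, hcN⟩ := petersson_lower_bound_log_of_noExceptionalZero_nonCM h
  have h3ε : (0 : ℝ) < (3 : ℝ) ^ ε := Real.rpow_pos_of_pos (by norm_num) _
  refine ⟨c * ε / (3 : ℝ) ^ ε, by positivity, fun N _ W _ f hf hCM ↦ ?_⟩
  have hN0 : (0 : ℝ) < N := Nat.cast_pos.mpr (NeZero.pos N)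
  have hlogN0 : 0 < Real.log ((N : ℝ) + 2) := Real.log_pos (by linarith)
  have hmain := hcN N W f hf hCM
  -- `log(N+2) ≤ (3N)^ε/ε`
  have hlog : Real.log (N + 2) ≤ (3 : ℝ) ^ ε * (N : ℝ) ^ ε / ε := by
    have h1 : Real.log ((N : ℝ) + 2) ≤ ((N : ℝ) + 2) ^ ε / ε := Real.log_le_rpow_div (by positivity) hε
    have h2 : ((N : ℝ) + 2) ^ ε ≤ (3 * (N : ℝ)) ^ ε :=
      Real.rpow_le_rpow (by linarith) (by linarith [show (1 : ℝ) ≤ N by exact_mod_cast NeZero.one_le])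
        hε.le
    rw [Real.mul_rpow (by norm_num) hN0.le] at h2
    calc Real.log ((N : ℝ) + 2) ≤ ((N : ℝ) + 2) ^ ε / ε := h1
      _ ≤ (3 : ℝ) ^ ε * (N : ℝ) ^ ε / ε := by gcongr
  calc c * ε / (3 : ℝ) ^ ε * (N : ℝ) ^ (1 - ε)
      = c * N / ((3 : ℝ) ^ ε * (N : ℝ) ^ ε / ε) := by
        rw [Real.rpow_sub hN0, Real.rpow_one]
        field_simp
    _ ≤ c * N / Real.log (N + 2) := by
        apply div_le_div_of_nonneg_left (by positivity) hlogN0 hlog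
    _ ≤ (peterssonProduct (Gamma0 N) 2 f f).re := hmain

/-! ### The family `j = 0`: from the `symmSqLOne` shape to the Petersson shape -/

/-- The bound on the family `j = 0` in the shape `hCM0` of
`murty_petersson_newform_lower_bound_of_pairData_nonCM_of_j_zero` (`c N^{−ε} ≤ symmSqLOne f`) gives
`c N^{1−ε}/(8π³) ≤ Re (f,f)`, since `symmSqLOne f = 8π³ Re(f,f)/N` (`symmSqLOne_eq`).
Deprecated: use `exists_petersson_ge_of_j_eq_zero` (unconditional) directly.
[cite: HoffsteinLockhart1994, Thm. 0.1 (the CM case)] -/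
@[deprecated exists_petersson_ge_of_j_eq_zero (since := "2026-08-16")]
theorem petersson_lower_bound_of_symmSqLOne_j_zero
    (_hCM0 : ∀ ε : ℝ, 0 < ε → ∃ c : ℝ, 0 < c ∧ ∀ j : EllipticNewformIndex, j.W.j = 0 →
      c * (j.N : ℝ) ^ (-ε) ≤ symmSqLOne j.f)
    {ε : ℝ} (hε : 0 < ε) :
    ∃ c : ℝ, 0 < c ∧ ∀ (N : ℕ) [NeZero N] (W : WeierstrassCurve ℚ) [W.IsElliptic]
      (f : CuspForm (Gamma0 N) 2), IsNewformOf W f → W.j = 0 →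
        c * (N : ℝ) ^ (1 - ε) ≤ (peterssonProduct (Gamma0 N) 2 f f).re :=
  -- SUPERSEDED reduction: the conclusion is proved unconditionally in the tree as
  -- `exists_petersson_ge_of_j_eq_zero` (NewformSymmSquareJ0Hecke.lean), so the CM-input `hCM0`
  -- is no longer needed (librarian dedup-02178, dedup-02424: now deprecated, no users left).
  exists_petersson_ge_of_j_eq_zero hε

/-! ### The named fact -/

/-- **`murty_petersson_newform_lower_bound` from "no exceptional zero" on the NON-CM members and any
bound on the CM members.** For `ε > 0`: the non-CM newforms get `c₁ N^{1−ε}`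
(`petersson_lower_bound_of_noExceptionalZero_nonCM`), the CM ones `c₂ N^{1−ε}` by hypothesis;
`c = min c₁ c₂`. [cite: HoffsteinLockhart1994, Thm. 0.1 and Appendix] [cite: MurtyCongruencePrimes1999, §2 (3)] -/
theorem murty_petersson_newform_lower_bound_of_noExceptionalZero_nonCM_of_hasCM
    (h : ∃ c₀ : ℝ, 0 < c₀ ∧ ∀ (N : ℕ) [NeZero N] (W : WeierstrassCurve ℚ) [W.IsElliptic]
      (f : CuspForm (Gamma0 N) 2), IsNewformOf W f → ¬ W.HasCM →
        ∀ σ : ℝ, 1 - c₀ / Real.log (N + 2) ≤ σ → σ < 1 → symmSqL N f σ ≠ 0)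
    (hCM : ∀ ε : ℝ, 0 < ε → ∃ c : ℝ, 0 < c ∧ ∀ (N : ℕ) [NeZero N] (W : WeierstrassCurve ℚ)
      [W.IsElliptic] (f : CuspForm (Gamma0 N) 2), IsNewformOf W f → W.HasCM →
        c * (N : ℝ) ^ (1 - ε) ≤ (peterssonProduct (Gamma0 N) 2 f f).re) :
    murty_petersson_newform_lower_bound := by
  intro ε hε
  obtain ⟨c₁, hc₁, h₁⟩ := petersson_lower_bound_of_noExceptionalZero_nonCM h hε
  obtain ⟨c₂, hc₂, h₂⟩ := hCM ε hε
  refine ⟨min c₁ c₂, lt_min hc₁ hc₂, fun N _ W _ f hf ↦ ?_⟩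
  have hN : (0 : ℝ) ≤ (N : ℝ) ^ (1 - ε) := Real.rpow_nonneg (Nat.cast_nonneg _) _
  by_cases hW : W.HasCM
  · exact (mul_le_mul_of_nonneg_right (min_le_right _ _) hN).trans (h₂ N W f hf hW)
  · exact (mul_le_mul_of_nonneg_right (min_le_left _ _) hN).trans (h₁ N W f hf hW)

/-- **`murty_petersson_newform_lower_bound` from "no exceptional zero" on the non-CM members and the
bound on the single CM family `j = 0`** (the CM curves with `j ≠ 0` are theorems:
`exists_petersson_ge_of_hasCM_of_j_ne_zero`). The two hypotheses are, respectively, the theorem of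
Goldfeld–Hoffstein–Lieman (IK Thm. 5.44 (2); named form
`GoldfeldHoffsteinLieman1994_symmSq_noExceptionalZero`) and `L(Sym² f, 1) ≫_ε N^{−ε}` for
`y² = x³ + k` (Hecke `L`-functions of `ℚ(√−3)`), in the shape `hCM0` of
`murty_petersson_newform_lower_bound_of_pairData_nonCM_of_j_zero`. The second hypothesis is no
longer used (the `j = 0` bound is the tree theorem `exists_petersson_ge_of_j_eq_zero`): this theorem is
superseded by `murty_petersson_newform_lower_bound_of_noExceptionalZero_nonCM` below and deprecated.
[cite: HoffsteinLockhart1994, Thm. 0.1 and Appendix] [cite: IwaniecKowalski2004, Thm. 5.44 (2) and Cor. 5.45] [cite: MurtyCongruencePrimes1999, §2 (3)] -/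
@[deprecated "superseded by murty_petersson_newform_lower_bound_of_noExceptionalZero_nonCM (the j = 0 input is a theorem of the tree)" (since := "2026-08-16")]
theorem murty_petersson_newform_lower_bound_of_noExceptionalZero_nonCM_of_j_zero
    (h : ∃ c₀ : ℝ, 0 < c₀ ∧ ∀ (N : ℕ) [NeZero N] (W : WeierstrassCurve ℚ) [W.IsElliptic]
      (f : CuspForm (Gamma0 N) 2), IsNewformOf W f → ¬ W.HasCM →
        ∀ σ : ℝ, 1 - c₀ / Real.log (N + 2) ≤ σ → σ < 1 → symmSqL N f σ ≠ 0)
    (_hCM0 : ∀ ε : ℝ, 0 < ε → ∃ c : ℝ, 0 < c ∧ ∀ j : EllipticNewformIndex, j.W.j = 0 →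
      c * (j.N : ℝ) ^ (-ε) ≤ symmSqLOne j.f) :
    murty_petersson_newform_lower_bound := by
  refine murty_petersson_newform_lower_bound_of_noExceptionalZero_nonCM_of_hasCM h fun ε hε ↦ ?_
  obtain ⟨c₂, hc₂, h₂⟩ := exists_petersson_ge_of_hasCM_of_j_ne_zero hε
  obtain ⟨c₃, hc₃, h₃⟩ := exists_petersson_ge_of_j_eq_zero hε
  refine ⟨min c₂ c₃, lt_min hc₂ hc₃, fun N _ W _ f hf hW ↦ ?_⟩
  have hN : (0 : ℝ) ≤ (N : ℝ) ^ (1 - ε) := Real.rpow_nonneg (Nat.cast_nonneg _) _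
  by_cases hj : W.j = 0
  · exact (mul_le_mul_of_nonneg_right (min_le_right _ _) hN).trans (h₃ N W f hf hj)
  · exact (mul_le_mul_of_nonneg_right (min_le_left _ _) hN).trans (h₂ N W f hf hW hj)

/-- The same with the `j = 0` input in Petersson shape. [cite: HoffsteinLockhart1994, Thm. 0.1 and Appendix] [cite: MurtyCongruencePrimes1999, §2 (3)] -/
theorem murty_petersson_newform_lower_bound_of_noExceptionalZero_nonCM_of_j_zero'
    (h : ∃ c₀ : ℝ, 0 < c₀ ∧ ∀ (N : ℕ) [NeZero N] (W : WeierstrassCurve ℚ) [W.IsElliptic]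
      (f : CuspForm (Gamma0 N) 2), IsNewformOf W f → ¬ W.HasCM →
        ∀ σ : ℝ, 1 - c₀ / Real.log (N + 2) ≤ σ → σ < 1 → symmSqL N f σ ≠ 0)
    (hP0 : ∀ ε : ℝ, 0 < ε → ∃ c : ℝ, 0 < c ∧ ∀ (N : ℕ) [NeZero N] (W : WeierstrassCurve ℚ)
      [W.IsElliptic] (f : CuspForm (Gamma0 N) 2), IsNewformOf W f → W.j = 0 →
        c * (N : ℝ) ^ (1 - ε) ≤ (peterssonProduct (Gamma0 N) 2 f f).re) :
    murty_petersson_newform_lower_bound := by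
  refine murty_petersson_newform_lower_bound_of_noExceptionalZero_nonCM_of_hasCM h fun ε hε ↦ ?_
  obtain ⟨c₂, hc₂, h₂⟩ := exists_petersson_ge_of_hasCM_of_j_ne_zero hε
  obtain ⟨c₃, hc₃, h₃⟩ := hP0 ε hε
  refine ⟨min c₂ c₃, lt_min hc₂ hc₃, fun N _ W _ f hf hW ↦ ?_⟩
  have hN : (0 : ℝ) ≤ (N : ℝ) ^ (1 - ε) := Real.rpow_nonneg (Nat.cast_nonneg _) _
  by_cases hj : W.j = 0
  · exact (mul_le_mul_of_nonneg_right (min_le_right _ _) hN).trans (h₃ N W f hf hj)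
  · exact (mul_le_mul_of_nonneg_right (min_le_left _ _) hN).trans (h₂ N W f hf hW hj)

/-- **The non-CM effective statement in the shape of the named fact's conclusion** (IK (5.104)
restricted to elliptic newforms): from "no exceptional zero", for every `ε > 0` a `c > 0` with
`c N^{1−ε} ≤ Re (f,f)` for all non-CM `W` — i.e. `murty_petersson_newform_lower_bound` holds
verbatim on the non-CM members. [cite: IwaniecKowalski2004, Cor. 5.45 (5.104)] -/
theorem murty_petersson_newform_lower_bound_nonCM_of_noExceptionalZero
    (h : ∃ c₀ : ℝ, 0 < c₀ ∧ ∀ (N : ℕ) [NeZero N] (W : WeierstrassCurve ℚ) [W.IsElliptic]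
      (f : CuspForm (Gamma0 N) 2), IsNewformOf W f → ¬ W.HasCM →
        ∀ σ : ℝ, 1 - c₀ / Real.log (N + 2) ≤ σ → σ < 1 → symmSqL N f σ ≠ 0) :
    ∀ ε : ℝ, 0 < ε → ∃ c : ℝ, 0 < c ∧
      ∀ (N : ℕ) [NeZero N] (W : WeierstrassCurve ℚ) [W.IsElliptic] (f : CuspForm (Gamma0 N) 2),
        IsNewformOf W f → ¬ W.HasCM →
          c * (N : ℝ) ^ (1 - ε) ≤ (peterssonProduct (Gamma0 N) 2 f f).re :=
  fun _ hε ↦ petersson_lower_bound_of_noExceptionalZero_nonCM h hε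


/-! ### The named fact from "no exceptional zero" on the non-CM members ALONE -/

/-- **`murty_petersson_newform_lower_bound` ⇐ Goldfeld–Hoffstein–Lieman on the non-CM elliptic
newforms, and nothing else.** The CM members are theorems of the tree: `j ≠ 0`
(`exists_petersson_ge_of_hasCM_of_j_ne_zero`: `j = 1728` through Hecke `L`-functions of `ℚ(i)`, the
eleven other invariants through quadratic-twist classes) and `j = 0` (`exists_petersson_ge_of_j_eq_zero`:
Hecke `L`-functions of `ℚ(√−3)`). The remaining hypothesis is Iwaniec–Kowalski Thm. 5.44 (2) =
the appendix theorem of Goldfeld–Hoffstein–Lieman in the special case of weight `2`, trivial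
character, non-CM elliptic newforms, real zeros and the tree's continued imprimitive `L_f = symmSqL N f`:
`∃ c > 0, ∀ N W f, IsNewformOf W f → ¬ W.HasCM → ∀ σ, 1 − c/log(N+2) ≤ σ < 1 → L_f(σ) ≠ 0`.
[cite: IwaniecKowalski2004, Thm. 5.44 (2) and Cor. 5.45] [cite: HoffsteinLockhart1994, Thm. 0.1 and Appendix] [cite: MurtyCongruencePrimes1999, §2 (3)] -/
theorem murty_petersson_newform_lower_bound_of_noExceptionalZero_nonCM
    (h : ∃ c₀ : ℝ, 0 < c₀ ∧ ∀ (N : ℕ) [NeZero N] (W : WeierstrassCurve ℚ) [W.IsElliptic]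
      (f : CuspForm (Gamma0 N) 2), IsNewformOf W f → ¬ W.HasCM →
        ∀ σ : ℝ, 1 - c₀ / Real.log (N + 2) ≤ σ → σ < 1 → symmSqL N f σ ≠ 0) :
    murty_petersson_newform_lower_bound :=
  murty_petersson_newform_lower_bound_of_noExceptionalZero_nonCM_of_j_zero' h
    fun _ hε ↦ exists_petersson_ge_of_j_eq_zero hε

/-- The same in the `A`-form of the hypothesis (`L_f(σ) ≠ 0` for `1 − 1/(A log(N+2)) ≤ σ < 1` on the
non-CM members; `c₀ = 1/A`). [cite: IwaniecKowalski2004, Thm. 5.44 (2) and Cor. 5.45] [cite: HoffsteinLockhart1994, Thm. 0.1 and Appendix] -/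
theorem murty_petersson_newform_lower_bound_of_noExceptionalZero_nonCM_A
    (h : ∃ A : ℝ, 0 < A ∧ ∀ (N : ℕ) [NeZero N] (W : WeierstrassCurve ℚ) [W.IsElliptic]
      (f : CuspForm (Gamma0 N) 2), IsNewformOf W f → ¬ W.HasCM →
        ∀ σ : ℝ, 1 - 1 / (A * Real.log (N + 2)) ≤ σ → σ < 1 → symmSqL N f σ ≠ 0) :
    murty_petersson_newform_lower_bound := by
  obtain ⟨A, hA, h⟩ := h
  refine murty_petersson_newform_lower_bound_of_noExceptionalZero_nonCM
    ⟨1 / A, by positivity, fun N _ W _ f hf hCM σ h1 h2 ↦ h N W f hf hCM σ ?_ h2⟩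
  have : 1 / A / Real.log (N + 2) = 1 / (A * Real.log (N + 2)) := by rw [div_div]
  rwa [this] at h1

end Literature.NumberTheory.EllipticCurves.ModularForms

end
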